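import Summits.QuantumFields.BalabanUV.T4Continuum.Spine.NE3.CurvedLandauNewtonStep
import HarnessLib

/-!
# T⁴ programme, node NE3 — [B8] AT THE FLAT BACKGROUND, brick E, letter 4a: THE NEWTON SCHEME — the sequence of gauges
# `u_{i+1} = e^{λ_i}·u_i` (λ_i = the linear Landau correction of `log U^{u_i}`) exists with the Landau defect HALVING at each step,
# `‖Δ_1λ_i‖_∞ ≤ c_R b₀·2^{−i}`, under ONE displayed smallness line in `M·r₀`, `M²·b₀`, `c₀, c₁, c_R, d` (`FlatLandauNewtonScheme`)

Cell `pub-balaban`, rung (B)+1 sub-cell t4, row NE3 (OWNER lineage `b2b-balaban-t4-ne3-p1`, generation 27; technique of record: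
implicit-function ∕ contraction mapping).  Fourth file of the chain «BRICK E OF REP♭ AT FLAT PAIRS» ([Balaban1985RegularSpaces] Sect. E, Prop. 5
(1.100) AT THE FLAT BACKGROUND on the T⁴ programme's lattice; asked of «row NE3's owner» by the CRUX prover NE7: HOME/INBOX [NE7P1-G72-INBOX-4],
`t4/b2b-balaban-t4-ne7-p1-g72/REP-FLAT-CRUX-CARD.md` N3, `t4/b2b-balaban-t4-ne7-p1-g73/REP-FLAT-ROAD-v2.md` §4 brick E), over letter 3
`FlatLandauNewtonStep.newton_step` and row NE3's `LandauProjectionB8.exists_landauB8_correction`.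

THE SCHEME.  `U` unitary `(N·L^{j+1})`-periodic with `‖U(b) − 1‖ ≤ r₀` and `‖covDiv 1 (log U)‖_∞ ≤ b₀`; `D₀ := c_R·b₀`, `M := L^{j+1}`.  Start
`u_0 = 1`; given `u_i`, let `λ_i ∈ N(Q′(1))` be A linear Landau correction of `log U^{u_i}` (exists by `exists_landauB8_correction` at `W = 1`; chosen)
and `u_{i+1} := e^{λ_i}·u_i`.  INVARIANT (`newton_step` + induction): `u_i` unitary periodic, `‖U^{u_i}(b) − 1‖ ≤ r₀ + (5∕2)c₁MD₀(1 − 2^{−i})`,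
`‖covDiv 1 log U^{u_i}‖_∞ ≤ b₀ + 3D₀(1 − 2^{−i})`, `‖Δ_1λ_i‖_∞ ≤ D₀·2^{−i}`, `‖u_i − 1‖ ≤ 4c₀M²D₀(1 − 2^{−i})`, `‖u_{i+1} − u_i‖ ≤ 2c₀M²D₀·2^{−i}`,
PROVIDED `0 ≤ c₀, c₁`, `1 ≤ c_R`, the regime `c₀M²D₀ ≤ 1∕10`, `c₁MD₀ ≤ 1∕25`, `r̄ := r₀ + (5∕2)c₁MD₀ ≤ 1∕20` and THE LINE
  `c_R·(4c₀M²(b₀ + 4D₀) + 25·d·r̄·(c₁M) + 14·d·(c₁M)²·D₀) ≤ 1∕2`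
(all `O(1)` iff `M·r₀`, `M²·b₀` are small against `c₀, c₁, c_R, d` — the (−1)∕(−2)-size currencies of [Balaban1985RegularSpaces] (1.36)).

WHAT ([folklore]; `d ≥ 1`, `n : Type*` nonempty finite, `L ≥ 2`, `N ≥ 1`; 0 def, 0 sorry):
* **`exists_newton_sequence`** — `∃ useq : ℕ → gauges`, for every `i`: unitary, periodic, the four displayed bounds with the UNIFORM radii `r̄`,
  `b̄ := b₀ + 3D₀`, the geometric increments, and `∃ λ ∈ N(Q′(1))` with `log U^{u_i} + D_1λ` (1.38)-Landau and `‖Δ_1λ‖_∞ ≤ D₀·2^{−i}`.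

HONEST FRAMING (page 1): elementary; the (H0)∕(HR) letters are hypotheses BY SHAPE (both PROVED at the flat datum in the tree); nothing of Bałaban's is
used, asserted or discharged; brick E is NOT landed by this file (letter 4b passes to the limit); REP♭ NOT proved; NE3 ∕ NE7 NOT proved; spine PROVED
0∕9; finite T⁴ rung (B)+1 — NOT infinite volume, NOT mass gap, NOT `BetaPertH`, NOT Clay.  Continuum YM on T⁴ ⇐ BetaPertH ∧ nine spine estimates
(0/9 proved); BetaPertH ⇐ (D1) ∧ (D4) ∧ CAP+tail; G-an2-4 gates asym, D1 and NE2/3/4.  PLACEMENT: our lemma, `Spine/NE3/`.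
-/

set_option autoImplicit false

open NormedSpace
open scoped BigOperators Matrix.Norms.L2Operator
open Finset

namespace Summit.QuantumFields.BalabanUV.T4Continuum.NE3.CurvedLandauNewtonScheme

open Literature.MathematicalPhysics.QuantumFieldTheory.Balaban1983to89
open B7Prop1Explicit B7Prop2Explicit MatrixLog
open T4AveragingDeficitWall (Ad IsUnitaryCfg IsSkewDir)
open T4AveragingDeficitWallBoundary (IsPeriodicCfg periodBox)
open AveragingDeficitPeriodicCounting (IsPeriodicDir)
open AveragingDeficitMultiLevelPrep (LevelSmall)
open T4AveragingDeficitWall (SmallField)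
open NE3EnergyShapes (IsUnitarySite IsPeriodicSite gaugeAct_one)
open NE3CovariantWeitzenbock (covDiv)
open NE3CurvedCornerGaugeSpace (covDiv_mem_skewAdjoint)
open NE3CovariantCalculus (hsR)
open BlockAveragePushDirGauge (gaugeDir)
open NE3.PairLandauB8 (avgKernelGauges IsLandauB8 covLapSite)
open NE3.LandauProjectionB8 (exists_landauB8_correction)
open NE3.LandauCorrectionSupB8Flat (sum_hsR_covDiv_add_covLapSite_eq_zero_of_isLandauB8)
open NE3LandauOrbit (covDiv_add_period)
open NE3.CurvedLandauNewtonStep (newton_step_W isPeriodicDir_mlog_rel isSkewDir_mlog_rel)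

noncomputable section

variable {d : ℕ} {n : Type*} [Fintype n] [DecidableEq n]

/-- **THE NEWTON SEQUENCE OF THE FLAT LANDAU SCHEME EXISTS, WITH GEOMETRICALLY DECAYING LANDAU DEFECT** (statement in the module docstring;
every `d ≥ 1`, `L ≥ 2`, `N ≥ 1`, level `j+1`; the flat sup letters (H0) `hG`, (HR) `hR` as hypotheses with constants `0 ≤ c₀, c₁`, `1 ≤ c_R`).
[folklore] -/
theorem exists_newton_sequence_W [Nonempty n] (hd : 1 ≤ d) {L N : ℕ} (hL : 2 ≤ L) (hN : 1 ≤ N) (j : ℕ) {c₀ c₁ cR : ℝ}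
    (hc₀ : 0 ≤ c₀) (hc₁ : 0 ≤ c₁) (hcR : 1 ≤ cR)
    {W : Site d → Fin d → (Matrix n n ℂ)ˣ} (hWu : IsUnitaryCfg W) (hWP : IsPeriodicCfg W ((N * L ^ (j + 1) : ℕ) : ℤ))
    {x : ℝ} (hx : 0 ≤ x) (hs : LevelSmall d L j x) (hWx : SmallField W x)
    (hG : ∀ mu ∈ avgKernelGauges (d := d) (n := n) L N (j + 1) W, ∀ B : ℝ,
      (∀ y : Site d, ‖covLapSite W mu y‖ ≤ B) →
        (∀ y : Site d, ‖mu y‖ ≤ c₀ * ((L : ℝ) ^ (j + 1)) ^ 2 * B) ∧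
        (∀ (y : Site d) (μ : Fin d), ‖gaugeDir W mu y μ‖ ≤ c₁ * (L : ℝ) ^ (j + 1) * B))
    (hR : ∀ (F : Site d → (Matrix n n ℂ)), (∀ y : Site d, F y ∈ skewAdjoint (Matrix n n ℂ)) →
      (∀ (y : Site d) (i : Fin d), F (y + ((N * L ^ (j + 1) : ℕ) : ℤ) • e i) = F y) →
      ∀ mu ∈ avgKernelGauges (d := d) (n := n) L N (j + 1) W,
        (∀ nu ∈ avgKernelGauges (d := d) (n := n) L N (j + 1) W,
          ∑ y ∈ periodBox (d := d) (N * L ^ (j + 1)),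
            hsR (F y + covLapSite W mu y) (covLapSite W nu y) = 0) →
        ∀ B : ℝ, (∀ y : Site d, ‖F y‖ ≤ B) → ∀ y : Site d, ‖covLapSite W mu y‖ ≤ cR * B)
    {U : Site d → Fin d → (Matrix n n ℂ)ˣ} (hUu : IsUnitaryCfg U) (hUP : IsPeriodicCfg U ((N * L ^ (j + 1) : ℕ) : ℤ))
    {r₀ b₀ : ℝ} (hr₀ : ∀ (y : Site d) (μ : Fin d), ‖(((W y μ)⁻¹ * U y μ : (Matrix n n ℂ)ˣ) : (Matrix n n ℂ)) - 1‖ ≤ r₀)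
    (hb₀ : ∀ x : Site d, ‖covDiv W (fun y μ => mlog (((W y μ)⁻¹ * U y μ : (Matrix n n ℂ)ˣ) : (Matrix n n ℂ))) x‖ ≤ b₀)
    (hreg₁ : c₀ * ((L : ℝ) ^ (j + 1)) ^ 2 * (cR * b₀) ≤ 1 / 10) (hreg₂ : c₁ * (L : ℝ) ^ (j + 1) * (cR * b₀) ≤ 1 / 25)
    (hreg₃ : r₀ + 5 / 2 * (c₁ * (L : ℝ) ^ (j + 1) * (cR * b₀)) ≤ 1 / 20)
    (hline : cR * (4 * (c₀ * ((L : ℝ) ^ (j + 1)) ^ 2) * (b₀ + 4 * (cR * b₀))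
        + 25 * d * (r₀ + 5 / 2 * (c₁ * (L : ℝ) ^ (j + 1) * (cR * b₀))) * (c₁ * (L : ℝ) ^ (j + 1))
        + 14 * d * (c₁ * (L : ℝ) ^ (j + 1)) ^ 2 * (cR * b₀)) ≤ 1 / 2) :
    ∃ useq : ℕ → (Site d → (Matrix n n ℂ)ˣ), ∀ i : ℕ,
      IsUnitarySite (useq i) ∧ IsPeriodicSite (useq i) ((N * L ^ (j + 1) : ℕ) : ℤ) ∧
      (∀ (y : Site d) (μ : Fin d), ‖(((W y μ)⁻¹ * gaugeAct (useq i) U y μ : (Matrix n n ℂ)ˣ) : (Matrix n n ℂ)) - 1‖ ≤ r₀ + 5 / 2 * (c₁ * (L : ℝ) ^ (j + 1) * (cR * b₀))) ∧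
      (∀ x : Site d, ‖covDiv W (fun y μ => mlog (((W y μ)⁻¹ * gaugeAct (useq i) U y μ : (Matrix n n ℂ)ˣ) : (Matrix n n ℂ))) x‖ ≤ b₀ + 3 * (cR * b₀)) ∧
      (∀ y : Site d, ‖((useq (i + 1) y : (Matrix n n ℂ)ˣ) : (Matrix n n ℂ)) - useq i y‖ ≤ 2 * (c₀ * ((L : ℝ) ^ (j + 1)) ^ 2 * (cR * b₀)) * (1 / 2) ^ i) ∧
      (∀ y : Site d, ‖((useq i y : (Matrix n n ℂ)ˣ) : (Matrix n n ℂ)) - 1‖ ≤ 4 * (c₀ * ((L : ℝ) ^ (j + 1)) ^ 2 * (cR * b₀))) ∧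
      ∃ lam ∈ avgKernelGauges (d := d) (n := n) L N (j + 1) W,
        IsLandauB8 (d := d) L N (j + 1) W
          (fun y κ => mlog (((W y κ)⁻¹ * gaugeAct (useq i) U y κ : (Matrix n n ℂ)ˣ) : (Matrix n n ℂ)) + gaugeDir W lam y κ) ∧
        ∀ y : Site d, ‖covLapSite W lam y‖ ≤ (cR * b₀) * (1 / 2) ^ i := by
  have hL1 : 1 ≤ L := by omega
  have hP : 1 ≤ N * L ^ (j + 1) := Nat.mul_pos (by omega) (Nat.pow_pos (by omega))
  set M : ℝ := (L : ℝ) ^ (j + 1) with hM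
  set D₀ : ℝ := cR * b₀ with hD₀
  have hd' : 0 < d := hd
  have hr₀0 : 0 ≤ r₀ := (norm_nonneg _).trans (hr₀ 0 ⟨0, hd'⟩)
  have hb₀0 : 0 ≤ b₀ := (norm_nonneg _).trans (hb₀ 0)
  have hD₀0 : 0 ≤ D₀ := mul_nonneg (by linarith) hb₀0
  have hM0 : 0 ≤ M := by positivity
  -- the linear Landau correction, chosen
  have hex : ∀ u : Site d → (Matrix n n ℂ)ˣ, ∃ lam ∈ avgKernelGauges (d := d) (n := n) L N (j + 1) W,
      IsLandauB8 (d := d) L N (j + 1) W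
        (fun y κ => mlog (((W y κ)⁻¹ * gaugeAct u U y κ : (Matrix n n ℂ)ˣ) : (Matrix n n ℂ)) + gaugeDir W lam y κ) := fun u =>
    exists_landauB8_correction hL1 hN j hWu hWP hx hs hWx _
  choose lamOf hlamN hlamL using hex
  -- the scheme
  let step : (Site d → (Matrix n n ℂ)ˣ) → (Site d → (Matrix n n ℂ)ˣ) := fun u y => expUnit (lamOf u y) * u y
  let useq : ℕ → (Site d → (Matrix n n ℂ)ˣ) := fun i => step^[i] (fun _ => 1)
  have huseq_succ : ∀ i, useq (i + 1) = fun y => expUnit (lamOf (useq i) y) * useq i y := fun i => by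
    show step^[i + 1] (fun _ => 1) = step (step^[i] (fun _ => 1))
    rw [Function.iterate_succ_apply']
  have huseq_zero : useq 0 = fun _ => 1 := rfl
  -- the sharp invariant
  have inv : ∀ i : ℕ,
      IsUnitarySite (useq i) ∧ IsPeriodicSite (useq i) ((N * L ^ (j + 1) : ℕ) : ℤ) ∧
      (∀ (y : Site d) (μ : Fin d), ‖(((W y μ)⁻¹ * gaugeAct (useq i) U y μ : (Matrix n n ℂ)ˣ) : (Matrix n n ℂ)) - 1‖ ≤ r₀ + 5 / 2 * (c₁ * M * D₀) * (1 - (1 / 2) ^ i)) ∧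
      (∀ x : Site d, ‖covDiv W (fun y μ => mlog (((W y μ)⁻¹ * gaugeAct (useq i) U y μ : (Matrix n n ℂ)ˣ) : (Matrix n n ℂ))) x‖
        ≤ b₀ + 3 * D₀ * (1 - (1 / 2) ^ i)) ∧
      (∀ y : Site d, ‖covLapSite W (lamOf (useq i)) y‖ ≤ D₀ * (1 / 2) ^ i) ∧
      (∀ y : Site d, ‖((useq i y : (Matrix n n ℂ)ˣ) : (Matrix n n ℂ)) - 1‖ ≤ 4 * (c₀ * M ^ 2 * D₀) * (1 - (1 / 2) ^ i)) ∧
      (∀ y : Site d, ‖((useq (i + 1) y : (Matrix n n ℂ)ˣ) : (Matrix n n ℂ)) - useq i y‖ ≤ 2 * (c₀ * M ^ 2 * D₀) * (1 / 2) ^ i) := by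
    intro i
    induction i with
    | zero =>
      -- `u_0 = 1`: the field is `U` itself; the first defect from (HR) with `F = covDiv 1 log U`
      have hone : gaugeAct (useq 0) U = U := by rw [huseq_zero]; exact gaugeAct_one U
      have hU1 : IsUnitarySite (useq 0) := fun y => by rw [huseq_zero]; exact (unitaryUnits (Matrix n n ℂ)).one_mem
      have hU1P : IsPeriodicSite (useq 0) ((N * L ^ (j + 1) : ℕ) : ℤ) := fun y i => by simp [huseq_zero]
      have hZP : IsPeriodicDir (fun y μ => mlog (((W y μ)⁻¹ * U y μ : (Matrix n n ℂ)ˣ) : (Matrix n n ℂ))) ((N * L ^ (j + 1) : ℕ) : ℤ) :=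
        isPeriodicDir_mlog_rel hWP hUP
      have hZs : IsSkewDir (fun y μ => mlog (((W y μ)⁻¹ * U y μ : (Matrix n n ℂ)ˣ) : (Matrix n n ℂ))) :=
        isSkewDir_mlog_rel hWu hUu fun y μ => (hr₀ y μ).trans (by linarith only [hreg₃, mul_nonneg (mul_nonneg hc₁ hM0) hD₀0])
      have hlam0 := hlamN (useq 0)
      have hLan0 := hlamL (useq 0)
      rw [hone] at hLan0
      have hD0 : ∀ y : Site d, ‖covLapSite W (lamOf (useq 0)) y‖ ≤ cR * b₀ := by
        refine hR _ (fun y => covDiv_mem_skewAdjoint hWu hZs y) (covDiv_add_period hWP hZP) _ hlam0 ?_ b₀ hb₀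
        intro nu hnu
        exact sum_hsR_covDiv_add_covLapSite_eq_zero_of_isLandauB8 hP hWu hWP hZP hlam0.2.1 hLan0 hnu
      -- the first increment: `‖e^{λ₀} − 1‖ ≤ 2c₀M²D₀`
      have hΛ := (hG _ hlam0 _ hD0).1
      have hstep : ∀ y : Site d, ‖((useq (0 + 1) y : (Matrix n n ℂ)ˣ) : (Matrix n n ℂ)) - useq 0 y‖ ≤ 2 * (c₀ * M ^ 2 * D₀) * (1 / 2) ^ 0 := by
        intro y
        rw [huseq_succ 0, huseq_zero]
        simp only [mul_one, Units.val_one, pow_zero, val_expUnit]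
        have h := (norm_exp_sub_one_le_of_norm_le (hΛ y)).1
        refine h.trans ?_
        have h2 := NE7ExpLogSecondOrder.real_exp_sub_one_le_two_mul (ρ := c₀ * M ^ 2 * (cR * b₀))
          ((norm_nonneg _).trans (hΛ y)) (by linarith only [hreg₁])
        linarith only [h2]
      refine ⟨hU1, hU1P, fun y μ => ?_, fun x => ?_, fun y => ?_, fun y => ?_, hstep⟩
      · rw [hone]; simpa using hr₀ y μ
      · rw [hone]; simpa using hb₀ x
      · simpa [hD₀] using hD0 y
      · simp [huseq_zero]
    | succ i ih =>
      obtain ⟨hU_i, hP_i, hr_i, hb_i, hD_i, h1_i, hstep_i⟩ := ih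
      have hq0 : (0 : ℝ) ≤ (1 / 2) ^ i := by positivity
      have hq1 : ((1 : ℝ) / 2) ^ i ≤ 1 := pow_le_one₀ (by norm_num) (by norm_num)
      -- the step data
      set r : ℝ := r₀ + 5 / 2 * (c₁ * M * D₀) * (1 - (1 / 2) ^ i) with hr_def
      set b : ℝ := b₀ + 3 * D₀ * (1 - (1 / 2) ^ i) with hb_def
      set D : ℝ := D₀ * (1 / 2) ^ i with hD_def
      have hgam0 : 0 ≤ c₁ * M * D₀ := by positivity
      have h1q : 0 ≤ 1 - ((1 : ℝ) / 2) ^ i := by linarith only [hq1]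
      have h1q' : 1 - ((1 : ℝ) / 2) ^ i ≤ 1 := by linarith only [hq0]
      have hrr : r ≤ r₀ + 5 / 2 * (c₁ * M * D₀) := by
        have := mul_le_of_le_one_right (by positivity : 0 ≤ 5 / 2 * (c₁ * M * D₀)) h1q'
        rw [hr_def]; linarith only [this]
      have hr1 : r ≤ 1 / 20 := hrr.trans hreg₃
      have hbb : b ≤ b₀ + 3 * D₀ := by
        have := mul_le_of_le_one_right (by positivity : 0 ≤ 3 * D₀) h1q'
        rw [hb_def]; linarith only [this]
      have hDD : D ≤ D₀ := by rw [hD_def]; exact mul_le_of_le_one_right hD₀0 hq1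
      have hD0' : 0 ≤ D := by positivity
      have hr0' : 0 ≤ r := by
        have := mul_nonneg (by positivity : 0 ≤ 5 / 2 * (c₁ * M * D₀)) h1q
        rw [hr_def]; linarith only [this, hr₀0]
      have hb0' : 0 ≤ b := by
        have := mul_nonneg (by positivity : 0 ≤ 3 * D₀) h1q
        rw [hb_def]; linarith only [this, hb₀0]
      have hΛ1 : c₀ * M ^ 2 * D ≤ 1 / 10 := le_trans (by gcongr) hreg₁
      have hγ1 : c₁ * M * D ≤ 1 / 25 := le_trans (by gcongr) hreg₂
      have hNS := newton_step_W hd hL hN j hWu hWP hG hR hUu hUP hU_i hP_i hr_i hr1 hb_i (hlamN (useq i)) (hlamL (useq i)) hD_i hΛ1 hγ1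
        (huseq_succ i) (hlamN (useq (i + 1))) (hlamL (useq (i + 1)))
      obtain ⟨hU', hP', hr', hb', hD', hdu⟩ := hNS
      -- the uniform bracket `Θ ≤ Θ̄`, `c_R·Θ̄ ≤ 1∕2`
      set Θ : ℝ := 4 * (c₀ * M ^ 2) * (b + D) + 25 * d * r * (c₁ * M) + 14 * d * (c₁ * M) ^ 2 * D with hΘ
      have hd0 : (0 : ℝ) ≤ d := Nat.cast_nonneg d
      have hΘle : cR * Θ ≤ 1 / 2 := by
        refine le_trans ?_ hline
        rw [hΘ]
        have h1 : b + D ≤ b₀ + 4 * (cR * b₀) := by rw [hD₀] at hbb hDD; linarith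
        have h2 : r ≤ r₀ + 5 / 2 * (c₁ * M * (cR * b₀)) := by rw [hD₀] at hrr; exact hrr
        have h3 : D ≤ cR * b₀ := by rw [hD₀] at hDD; exact hDD
        have hcR0 : 0 ≤ cR := by linarith
        gcongr
      have hΘ0 : 0 ≤ Θ := by rw [hΘ]; positivity
      have hΘ1 : Θ ≤ 1 / 2 := by
        have := mul_le_mul_of_nonneg_right hcR hΘ0
        linarith only [this, hΘle]
      have hDΘ : D * Θ ≤ D / 2 := by
        have := mul_le_mul_of_nonneg_left hΘ1 hD0'
        linarith only [this]
      refine ⟨hU', hP', fun y μ => ?_, fun x => ?_, fun y => ?_, fun y => ?_, fun y => ?_⟩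
      · refine (hr' y μ).trans (le_of_eq ?_)
        rw [hr_def, hD_def, pow_succ]; ring
      · refine (hb' x).trans ?_
        have : b + D + D * Θ ≤ b + D + D / 2 := by linarith
        refine this.trans (le_of_eq ?_)
        rw [hb_def, hD_def, pow_succ]; ring
      · refine (hD' y).trans ?_
        calc cR * (D * Θ) = D * (cR * Θ) := by ring
          _ ≤ D * (1 / 2) := by gcongr
          _ = D₀ * (1 / 2) ^ (i + 1) := by rw [hD_def, pow_succ]; ring
      · calc ‖((useq (i + 1) y : (Matrix n n ℂ)ˣ) : (Matrix n n ℂ)) - 1‖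
            = ‖(((useq (i + 1) y : (Matrix n n ℂ)ˣ) : (Matrix n n ℂ)) - useq i y) + (((useq i y : (Matrix n n ℂ)ˣ) : (Matrix n n ℂ)) - 1)‖ := by rw [sub_add_sub_cancel]
          _ ≤ 2 * (c₀ * M ^ 2 * D₀) * (1 / 2) ^ i + 4 * (c₀ * M ^ 2 * D₀) * (1 - (1 / 2) ^ i) :=
              (norm_add_le _ _).trans (add_le_add (hstep_i y) (h1_i y))
          _ = 4 * (c₀ * M ^ 2 * D₀) * (1 - (1 / 2) ^ (i + 1)) := by rw [pow_succ]; ring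
      · -- the next increment `‖e^{λ_{i+1}} − 1‖ ≤ 2c₀M²D₀·2^{−(i+1)}`
        have hΛ' := (hG _ (hlamN (useq (i + 1))) _ hD').1
        rw [huseq_succ (i + 1)]
        have hu1 : ‖((useq (i + 1) y : (Matrix n n ℂ)ˣ) : (Matrix n n ℂ))‖ = 1 := CStarRing.norm_of_mem_unitary (mem_unitaryUnits.mp (hU' y))
        have hid : ((expUnit (lamOf (useq (i + 1)) y) * useq (i + 1) y : (Matrix n n ℂ)ˣ) : (Matrix n n ℂ)) - useq (i + 1) y
            = (exp (lamOf (useq (i + 1)) y) - 1) * ((useq (i + 1) y : (Matrix n n ℂ)ˣ) : (Matrix n n ℂ)) := by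
          rw [Units.val_mul, val_expUnit, sub_mul, one_mul]
        rw [hid]
        have hbd : cR * (D * Θ) ≤ D₀ * (1 / 2) ^ (i + 1) := by
          calc cR * (D * Θ) = D * (cR * Θ) := by ring
            _ ≤ D * (1 / 2) := by gcongr
            _ = D₀ * (1 / 2) ^ (i + 1) := by rw [hD_def, pow_succ]; ring
        have hΛ'' : ‖lamOf (useq (i + 1)) y‖ ≤ c₀ * M ^ 2 * (D₀ * (1 / 2) ^ (i + 1)) :=
          (hΛ' y).trans (by gcongr)
        have hsmall : c₀ * M ^ 2 * (D₀ * (1 / 2) ^ (i + 1)) ≤ 1 := by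
          have hq' : ((1 : ℝ) / 2) ^ (i + 1) ≤ 1 := pow_le_one₀ (by norm_num) (by norm_num)
          have : c₀ * M ^ 2 * (D₀ * (1 / 2) ^ (i + 1)) ≤ c₀ * M ^ 2 * D₀ :=
            mul_le_mul_of_nonneg_left (mul_le_of_le_one_right hD₀0 hq') (by positivity)
          linarith only [this, hreg₁]
        calc ‖(exp (lamOf (useq (i + 1)) y) - 1) * ((useq (i + 1) y : (Matrix n n ℂ)ˣ) : (Matrix n n ℂ))‖
            ≤ ‖exp (lamOf (useq (i + 1)) y) - 1‖ * ‖((useq (i + 1) y : (Matrix n n ℂ)ˣ) : (Matrix n n ℂ))‖ := norm_mul_le _ _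
          _ ≤ (2 * (c₀ * M ^ 2 * (D₀ * (1 / 2) ^ (i + 1)))) * 1 := by
              rw [hu1]
              refine mul_le_mul_of_nonneg_right ?_ zero_le_one
              exact (norm_exp_sub_one_le_of_norm_le hΛ'').1.trans
                (NE7ExpLogSecondOrder.real_exp_sub_one_le_two_mul ((norm_nonneg _).trans hΛ'') hsmall)
          _ = 2 * (c₀ * M ^ 2 * D₀) * (1 / 2) ^ (i + 1) := by ring
  -- the uniform form
  refine ⟨useq, fun i => ?_⟩
  obtain ⟨hU_i, hP_i, hr_i, hb_i, hD_i, h1_i, hstep_i⟩ := inv i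
  have hq0 : (0 : ℝ) ≤ (1 / 2) ^ i := by positivity
  have hq1 : ((1 : ℝ) / 2) ^ i ≤ 1 := pow_le_one₀ (by norm_num) (by norm_num)
  have hgam0 : 0 ≤ c₁ * M * D₀ := by positivity
  have hLam0 : 0 ≤ c₀ * M ^ 2 * D₀ := by positivity
  have h1q' : 1 - ((1 : ℝ) / 2) ^ i ≤ 1 := by linarith only [hq0]
  have e1 := mul_le_of_le_one_right (by positivity : 0 ≤ 5 / 2 * (c₁ * M * D₀)) h1q'
  have e2 := mul_le_of_le_one_right (by positivity : 0 ≤ 3 * D₀) h1q'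
  have e3 := mul_le_of_le_one_right (by positivity : 0 ≤ 4 * (c₀ * M ^ 2 * D₀)) h1q'
  refine ⟨hU_i, hP_i, fun y μ => (hr_i y μ).trans (by linarith only [e1]), fun x => (hb_i x).trans (by linarith only [e2]), hstep_i,
    fun y => (h1_i y).trans (by linarith only [e3]), lamOf (useq i), hlamN (useq i), hlamL (useq i), hD_i⟩

end

end Summit.QuantumFields.BalabanUV.T4Continuum.NE3.CurvedLandauNewtonScheme
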